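import Summits.Ventures.PercRepro0.Parity

/-!
# Closed primal walks have even edge sets; intersection parity (pub-perc-repro0, P9 §1, §3–§4)

Companion of `Summits.Ventures.PercRepro0.Parity` (the parity lemma `parity_closed_walk`).  The
paper file proofs/P9-separation-p1-v1.md applies the parity lemma to the edge set of a CYCLE
(§1: «the edge set of a cycle is even»); this file proves that bridge in Lean:

* `stepEdge x y` — the primal edge traversed by a step between adjacent vertices of `ℤ²`;
  `IsPWalk` — consecutive entries adjacent; `stepEdges` — the edges traversed;
* `isEvenSet_of_closed_walk` — a closed walk (`lastOf a L = a`) without repeated edges has an even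
  edge set (every vertex is incident to 0 or 2 of its edges; here proved by counting step endpoints);
* `parity_cycle_dual_walk` — a closed primal walk without repeated edges (e.g. a cycle) and a
  closed dual walk cross an even number of times.  P9 Lemmas 3.1 and 4.1 are instances: their
  explicit constructions produce exactly one crossing.

Imports only the landed `Parity` module (which imports Mathlib); no probability.
-/

namespace Summit.Ventures.PercRepro0.Parity

/-! ## Closed primal walks have even edge sets (the bridge to the cycles used in the paper) -/

/-- The primal edge traversed by the step from `x` to `y` (adjacent vertices of `ℤ²`); `none` if
`x`, `y` are not adjacent. -/
def stepEdge (x y : ℤ × ℤ) : Option Edge :=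
  if y = (x.1 + 1, x.2) then some (.h x.1 x.2)
  else if y = (x.1 - 1, x.2) then some (.h (x.1 - 1) x.2)
  else if y = (x.1, x.2 + 1) then some (.v x.1 x.2)
  else if y = (x.1, x.2 - 1) then some (.v x.1 (x.2 - 1))
  else none

/-- A vertex is not adjacent to itself. -/
theorem stepEdge_self (x : ℤ × ℤ) : stepEdge x x = none := by
  unfold stepEdge
  simp only [Prod.ext_iff]
  split_ifs <;> first | rfl | (exfalso; omega)

/-- A step's edge is incident exactly to the two vertices of the step. -/
theorem incident_stepEdge {x y : ℤ × ℤ} {e : Edge} (h : stepEdge x y = some e) (z : ℤ × ℤ) :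
    e.Incident z ↔ (z = x ∨ z = y) := by
  unfold stepEdge at h
  split_ifs at h with h1 h2 h3 h4 <;> simp only [Option.some.injEq] at h <;> subst h <;>
    (first | subst h1 | subst h2 | subst h3 | subst h4) <;>
    simp only [Edge.Incident, Edge.src, Edge.tgt, Prod.ext_iff] <;> omega

/-- A primal walk: consecutive entries are adjacent. -/
def IsPWalk : List (ℤ × ℤ) → Prop
  | [] => True
  | [_] => True
  | x :: y :: rest => (stepEdge x y).isSome ∧ IsPWalk (y :: rest)

/-- The list of edges traversed by a list of vertices (non-adjacent consecutive entries, which do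
not occur in a walk, contribute nothing). -/
def stepEdges : List (ℤ × ℤ) → List Edge
  | [] => []
  | [_] => []
  | x :: y :: rest =>
    match stepEdge x y with
    | some e => e :: stepEdges (y :: rest)
    | none => stepEdges (y :: rest)

/-- The number of step-endpoints equal to `z` along a list (each step contributes `[x = z] + [y = z]`). -/
def endSum (z : ℤ × ℤ) : List (ℤ × ℤ) → ℕ
  | [] => 0
  | [_] => 0
  | x :: y :: rest => (if x = z then 1 else 0) + (if y = z then 1 else 0) + endSum z (y :: rest)

/-- Every entry except the first and the last is counted twice by `endSum`; the first and the last once. -/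
theorem endSum_eq (z : ℤ × ℤ) :
    ∀ (L : List (ℤ × ℤ)) (a : ℤ × ℤ),
      endSum z (a :: L) + (if a = z then 1 else 0) + (if lastOf a L = z then 1 else 0)
        = 2 * (a :: L).count z := by
  intro L
  induction L with
  | nil =>
    intro a
    simp only [endSum, lastOf, List.count_cons, List.count_nil, beq_iff_eq, zero_add]
    split_ifs <;> omega
  | cons y rest ih =>
    intro a
    have h := ih y
    simp only [endSum, lastOf, List.count_cons, beq_iff_eq] at h ⊢
    split_ifs at h ⊢ <;> omega

/-- Along a walk, the incidence count of `z` over the traversed edges is `endSum z`. -/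
theorem incSum_eq_endSum (z : ℤ × ℤ) :
    ∀ (L : List (ℤ × ℤ)) (a : ℤ × ℤ), IsPWalk (a :: L) →
      ((stepEdges (a :: L)).map (fun e => if e.Incident z then 1 else 0)).sum = endSum z (a :: L) := by
  intro L
  induction L with
  | nil => intro a _; simp [stepEdges, endSum]
  | cons y rest ih =>
    intro a hw
    obtain ⟨hxy, hw'⟩ := hw
    obtain ⟨e, he⟩ := Option.isSome_iff_exists.mp hxy
    have h1 := ih y hw'
    simp only [stepEdges, he, List.map_cons, List.sum_cons, endSum]
    rw [h1]
    have hne : a ≠ y := by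
      intro hay; subst hay; rw [stepEdge_self] at he; simp at he
    have hinc : (if e.Incident z then (1 : ℕ) else 0)
        = (if a = z then 1 else 0) + (if y = z then 1 else 0) := by
      simp only [incident_stepEdge he z]
      by_cases ha : z = a
      · subst ha; simp [hne.symm]
      · by_cases hy : z = y
        · subst hy; simp [hne]
        · simp [ha, hy, Ne.symm ha, Ne.symm hy]
    rw [hinc]

/-- **A closed walk without repeated edges has an even edge set**: every vertex is incident to an
even number of its edges (the edge set of a cycle is even). -/
theorem isEvenSet_of_closed_walk (a : ℤ × ℤ) (L : List (ℤ × ℤ)) (hw : IsPWalk (a :: L))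
    (hclosed : lastOf a L = a) (hnd : (stepEdges (a :: L)).Nodup) :
    IsEvenSet (stepEdges (a :: L)).toFinset := by
  intro z
  have h := endSum_eq z L a
  rw [hclosed] at h
  have hdeg : deg (stepEdges (a :: L)).toFinset z
      = ((stepEdges (a :: L)).map (fun e => if e.Incident z then 1 else 0)).sum := by
    rw [deg, Finset.card_filter, List.sum_toFinset _ hnd]
  rw [hdeg, incSum_eq_endSum z L a hw]
  exact ⟨(a :: L).count z - (if a = z then 1 else 0), by omega⟩

/-- **Intersection parity**: a closed primal walk without repeated edges (e.g. a cycle) and a closed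
dual walk cross an even number of times. This is the form in which P9 Lemmas 3.1 and 4.1 use the
parity lemma: there the explicit constructions give exactly one crossing, a contradiction. -/
theorem parity_cycle_dual_walk (a : ℤ × ℤ) (L : List (ℤ × ℤ)) (hw : IsPWalk (a :: L))
    (hclosed : lastOf a L = a) (hnd : (stepEdges (a :: L)).Nodup)
    (f : ℤ × ℤ) (W : List (ℤ × ℤ)) (hW : IsWalk (f :: W)) (hWclosed : lastOf f W = f) :
    Even (crossCount (stepEdges (a :: L)).toFinset (f :: W)) :=
  parity_closed_walk _ (isEvenSet_of_closed_walk a L hw hclosed hnd) f W hW hWclosed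

end Summit.Ventures.PercRepro0.Parity
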